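import Summits.ValiantsHypothesis.ValiantsHypothesis.Theorems.FifoMatchingNNDivisionHardLocalizationWeightedPin
import Summits.ValiantsHypothesis.ValiantsHypothesis.Theorems.FifoMatchingNNDivisionHardLocatedRowsPairPencil

/-!
# FifoMatching · NNDivisionHard — localization, part 12: §B7 THE UNIQUE-DISJOINTNESS GENUS `UPat` (class, bound, rate, recipe)

Theorems-grade port (bytes staged by val-idea-43 g6 for a port hand) of §B7 of the crux workfile `Cruxes/NNDivisionHard/Symmetry43.lean`
REV 5 (val-idea-43 g6; crux `stmt-ValiantsHypothesis-21181` `FifoMatching.NNDivisionHard`) — statements and proofs VERBATIM, namespace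
`…Theorems.FifoMatching.Localization` (imports part 11 `…LocalizationWeightedPin` for `Hull`; uses part 7 `Face` / `delRead_image_corFace` /
`delRead_image_hullFace` / `face_mono` / `loc_le_face`, part 6 `decided_autStar`, part 3 `unitEntry`, part 1 `Decided` / `T_le_T_double` /
`corVirtualHard_of_residualLaw`, `CorSandwich.threshold_lt_of_rpow_bound`, Literature `HasEFOfSize.three_pow_le` (Yannakakis + Kaibel–Weltge)).

Genus I made universal: every budget-free species typed so far proves `T c h < r` through a UNIQUE-DISJOINTNESS PATTERN inside the slack
matrix of `COR(K_h) + conv q`.  §B7 types the pattern ITSELF as the class — rows `c a · y ≤ d a` valid on the sum and points `x b` of the sum,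
`a, b ⊆ Fin m`, slack `0` when `#(a ∩ b) = 1`, slack `> 0` when `a ∩ b = ∅` — so that the ROW may depend on `a` AND THE PASSENGER COLUMN POINT
ON `b` (no common maximiser, no single top, no located face).
* `UPatAt q m`, `UPatF s`, `UPat := UPatF ⌊√·⌋`; ★★ the bound `uPatAt_three_pow_le` (budget-free, any order), hull invariance
  `uPatAt_of_hull_eq`, the rate `T_lt_of_three_pow`, ★★ `decided_uPatF` (every unbounded floor with an exchange), `uPat_decided`, `uPat4_decided`,
  glue `corVirtualHard_of_residualLawUPat`, enemy side `enemy_no_pattern` (E-U).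
* the explicit RECIPE `uPatAt_of_rows` (UDISJ rows `udF ι a` pushed along `ι`, `udF_dotProduct_corVec : udF ι a · bbᵀ = t (2 − t)`; per-row
  tilts, per-column cliques AND generators), `uPatAt_of_commonTop`, `uPatAt_of_quiet`, `quiet_le_uPatF`.
* (part 13 `…LocalizationUPatFace`) ★★★ the CLOSURE under the free-face recursion without exchange `face_uPatF_le` and its corollaries,
  closure under `Hull`, `autStar_uPat_decided`.
ENEMY CLAUSE (E-U): a residual passenger's sum with `COR(K_h)` carries NO unique-disjointness pattern of order `⌊√h⌋` anywhere in its slack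
matrix (all valid rows × all points), in every rooting/switching and every presentation.

Honest label: a genus (one class containing the budget-free located species by name) + its closure theorems for the TOP cone; the budgeted
cone/MaxCut species are NOT claimed to be instances; NOT progress on `C′ = ExactPencilLaw` nor on `CoreLawFace`; 0 explicit residual members
before and after; 21181 OPEN; VP ≠ VNP NOT proved.
-/

set_option linter.unusedVariables false
set_option linter.unusedSectionVars false
set_option linter.dupNamespace false

namespace Summit.ValiantsHypothesis.ValiantsHypothesis.Theorems.FifoMatching.Localization

open Matrix Finset
open scoped Pointwise
open Literature.Barriers.PneNP (HasEFOfSize)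
open Literature.Combinatorics.Optimization (corPolytopeGraph corVec)

/-! ### the class and the bound -/

/-- **`UPatAt q m`**: the slack matrix of `COR(K_h) + conv q` carries a UNIQUE-DISJOINTNESS PATTERN of order `m` — valid inequalities
`c a · y ≤ d a` and points `x b` of the sum (`a, b ⊆ Fin m`) whose slacks VANISH whenever `#(a ∩ b) = 1` and are POSITIVE on disjoint pairs.
Rows may depend on `a`, columns (including their passenger part) on `b`. -/
def UPatAt {h K : ℕ} (q : Fam h K) (m : ℕ) : Prop :=
  ∃ (c : Finset (Fin m) → (Fin h × Fin h → ℝ)) (d : Finset (Fin m) → ℝ) (x : Finset (Fin m) → (Fin h × Fin h → ℝ)),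
    (∀ a, ∀ y ∈ corPolytopeGraph (⊤ : SimpleGraph (Fin h)) + convexHull ℝ (Set.range q), c a ⬝ᵥ y ≤ d a) ∧
    (∀ b, x b ∈ corPolytopeGraph (⊤ : SimpleGraph (Fin h)) + convexHull ℝ (Set.range q)) ∧
    (∀ a b, (a ∩ b).card = 1 → c a ⬝ᵥ x b = d a) ∧
    (∀ a b, Disjoint a b → c a ⬝ᵥ x b < d a)

/-- **`UPatF s`**: a unique-disjointness pattern of order at least `s h`. -/
def UPatF (s : ℕ → ℕ) : PClass := fun h K q => ∃ m, s h ≤ m ∧ UPatAt q m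

/-- **`UPat`** `:= UPatF ⌊√·⌋`. -/
def UPat : PClass := UPatF Nat.sqrt

/-- ★★ **THE PATTERN BOUND** (budget-free, any order): a unique-disjointness pattern of order `m` forces `(3/2)^m ≤ r + 1` for every EF of
size `r` of the sum (Yannakakis + Kaibel–Weltge, Literature `HasEFOfSize.three_pow_le`). -/
theorem uPatAt_three_pow_le {h K m : ℕ} {q : Fam h K} (hq : UPatAt q m) {r : ℕ}
    (hEF : HasEFOfSize (corPolytopeGraph (⊤ : SimpleGraph (Fin h)) + convexHull ℝ (Set.range q)) r) :
    3 ^ m ≤ (r + 1) * 2 ^ m := by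
  obtain ⟨c, d, x, hval, hx, htight, hdisj⟩ := hq
  exact hEF.three_pow_le x hx c d hval (fun a b hlt h1 => absurd (htight a b h1) (ne_of_lt hlt)) hdisj

/-- a pattern only sees the SET `COR(K_h) + conv q`: families with the same passenger hull carry the same patterns. -/
theorem uPatAt_of_hull_eq {h K K' m : ℕ} {q : Fam h K} {q' : Fam h K'} (he : convexHull ℝ (Set.range q') = convexHull ℝ (Set.range q))
    (hq : UPatAt q' m) : UPatAt q m := by
  obtain ⟨c, d, x, hval, hx, htight, hdisj⟩ := hq
  rw [he] at hval hx
  exact ⟨c, d, x, hval, hx, htight, hdisj⟩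

/-- floors are antitone: a higher floor is a smaller class. -/
theorem uPatF_mono {s s' : ℕ → ℕ} (hs : ∀ h, s' h ≤ s h) {h K : ℕ} {q : Fam h K} (hq : UPatF s h K q) : UPatF s' h K q := by
  obtain ⟨m, hm, hP⟩ := hq
  exact ⟨m, (hs h).trans hm, hP⟩

/-! ### the rate and decidedness -/

-- `two_pow_half_mul_le` is the tree's ✓ `…FifoMatching.LocatedRows.two_pow_half_mul_le` BY NAME (dedup; port hand val-lit-p3 g18).

/-- `√m ≤ ⌊m/2⌋ − 1` for `m ≥ 16`. -/
theorem sqrt_le_half_sub_one {m : ℕ} (hm : 16 ≤ m) : (m : ℝ) ^ (1 / 2 : ℝ) ≤ ((m / 2 : ℕ) : ℝ) - 1 := by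
  rw [← Real.sqrt_eq_rpow]
  set u := Real.sqrt m with hu
  have hm0 : (0 : ℝ) ≤ m := Nat.cast_nonneg m
  have hu2 : u ^ 2 = m := Real.sq_sqrt hm0
  have hu4 : 4 ≤ u := by
    rw [hu, show (4 : ℝ) = Real.sqrt 16 by rw [show (16 : ℝ) = 4 ^ 2 by norm_num, Real.sqrt_sq (by norm_num)]]
    exact Real.sqrt_le_sqrt (by exact_mod_cast hm)
  have hdiv : m ≤ 2 * (m / 2) + 1 := by omega
  have hdivR : (m : ℝ) ≤ 2 * ((m / 2 : ℕ) : ℝ) + 1 := by exact_mod_cast hdiv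
  nlinarith

/-- ★ **RATE**: `3^m ≤ (r+1)·2^m ⟹ T c m < r` for `m ≥ m₀(c)`. -/
theorem T_lt_of_three_pow (c : ℕ) : ∃ m₀ : ℕ, ∀ m ≥ m₀, ∀ r : ℕ, 3 ^ m ≤ (r + 1) * 2 ^ m → T c m < r := by
  obtain ⟨h₀, H⟩ := Summit.ValiantsHypothesis.ValiantsHypothesis.Theorems.FifoMatching.CorSandwich.threshold_lt_of_rpow_bound c
    (c₃ := 1 / 2) (by norm_num)
  refine ⟨max h₀ 16, fun m hm r hr => ?_⟩
  have hm16 : 16 ≤ m := le_of_max_le_right hm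
  have h1 : 2 ^ (m / 2) ≤ r + 1 := Nat.le_of_mul_le_mul_right ((Summit.ValiantsHypothesis.ValiantsHypothesis.Theorems.FifoMatching.LocatedRows.two_pow_half_mul_le m).trans hr) (by positivity)
  have h1R : ((2 : ℝ) ^ (m / 2) : ℝ) ≤ (r : ℝ) + 1 := by exact_mod_cast h1
  have h8 : (2 : ℝ) ^ 8 ≤ (2 : ℝ) ^ (m / 2) := pow_le_pow_right₀ (by norm_num) (by omega)
  have h2 : (2 : ℝ) ^ ((m : ℝ) ^ (1 / 2 : ℝ)) ≤ (2 : ℝ) ^ ((((m / 2 : ℕ) : ℝ)) - 1) :=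
    Real.rpow_le_rpow_of_exponent_le (by norm_num) (sqrt_le_half_sub_one hm16)
  have h3 : (2 : ℝ) ^ ((((m / 2 : ℕ) : ℝ)) - 1) = (2 : ℝ) ^ (m / 2) / 2 := by
    rw [Real.rpow_sub (by norm_num), Real.rpow_natCast, Real.rpow_one]
  have h4 : (2 : ℝ) ^ ((m : ℝ) ^ (1 / 2 : ℝ)) ≤ r := by
    rw [h3] at h2
    have : (2 : ℝ) ^ (m / 2) / 2 ≤ r := by
      rw [div_le_iff₀ (by norm_num : (0 : ℝ) < 2)]
      norm_num at h8
      linarith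
    exact h2.trans this
  exact H m (le_of_max_le_left hm) r h4

/-- ★★ **DECIDED for every admissible floor** (the floor grows unboundedly and admits an exchange `T c h ≤ T c' ℓ` for `ℓ ≥ s h`). -/
theorem decided_uPatF {s : ℕ → ℕ} (hgrow : ∀ h₀ : ℕ, ∃ h₁ : ℕ, ∀ h ≥ h₁, h₀ ≤ s h)
    (hex : ∀ c : ℕ, ∃ c' h₁ : ℕ, ∀ h ≥ h₁, ∀ ℓ, s h ≤ ℓ → T c h ≤ T c' ℓ) : Decided (UPatF s) := by
  intro c
  obtain ⟨c', h₁, hh₁⟩ := hex c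
  obtain ⟨m₀, hm₀⟩ := T_lt_of_three_pow c'
  obtain ⟨h₂, hh₂⟩ := hgrow m₀
  refine ⟨h₁ + h₂, fun h hh K q r hq hEF => ?_⟩
  obtain ⟨m, hm, hP⟩ := hq
  exact lt_of_le_of_lt (hh₁ h (by omega) m hm) (hm₀ m ((hh₂ h (by omega)).trans hm) r (uPatAt_three_pow_le hP hEF))

/-- ★★ **`UPat` IS DECIDED** (floor `⌊√h⌋`, exchange `c ↦ 2c`). -/
theorem uPat_decided : Decided UPat := by
  refine decided_uPatF ?_ ?_
  · intro h₀
    refine ⟨h₀ * h₀, fun h hh => ?_⟩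
    calc h₀ = Nat.sqrt (h₀ * h₀) := (Nat.sqrt_eq h₀).symm
      _ ≤ Nat.sqrt h := Nat.sqrt_le_sqrt hh
  · intro c
    exact ⟨2 * c, 0, fun h _ ℓ hℓ => T_le_T_double c hℓ⟩

/-- `UPat₄ := UPatF ⌊⌊√h⌋^{1/2}⌋` is decided (floor `h^{1/4}`, exchange `c ↦ 4c`). -/
theorem uPat4_decided : Decided (UPatF fun h => Nat.sqrt (Nat.sqrt h)) := by
  refine decided_uPatF ?_ ?_
  · intro h₀
    refine ⟨(h₀ * h₀) * (h₀ * h₀), fun h hh => ?_⟩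
    have e1 : Nat.sqrt ((h₀ * h₀) * (h₀ * h₀)) = h₀ * h₀ := Nat.sqrt_eq (h₀ * h₀)
    have s1 : h₀ * h₀ ≤ Nat.sqrt h := by
      calc h₀ * h₀ = Nat.sqrt ((h₀ * h₀) * (h₀ * h₀)) := e1.symm
        _ ≤ Nat.sqrt h := Nat.sqrt_le_sqrt hh
    calc h₀ = Nat.sqrt (h₀ * h₀) := (Nat.sqrt_eq h₀).symm
      _ ≤ Nat.sqrt (Nat.sqrt h) := Nat.sqrt_le_sqrt s1
  · intro c
    exact ⟨2 * (2 * c), 0, fun h _ ℓ hℓ => le_trans (T_le_T_double c (le_refl (Nat.sqrt h))) (T_le_T_double (2 * c) hℓ)⟩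

/-- glue: the residual law relative to `UPat` has the COR-VIRTUAL shape. -/
theorem corVirtualHard_of_residualLawUPat (hR : ResidualLaw UPat) : CorVirtualHard :=
  corVirtualHard_of_residualLaw uPat_decided hR

/-- **(E-U), enemy side**: below the threshold a passenger's sum carries NO unique-disjointness pattern of order `⌊√h⌋`. -/
theorem enemy_no_pattern (c : ℕ) : ∃ h₀ : ℕ, ∀ h ≥ h₀, ∀ (K : ℕ) (q : Fam h K) (r : ℕ),
    HasEFOfSize (corPolytopeGraph (⊤ : SimpleGraph (Fin h)) + convexHull ℝ (Set.range q)) r → r ≤ T c h → ¬ UPat h K q := by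
  obtain ⟨h₀, hh₀⟩ := uPat_decided c
  exact ⟨h₀, fun h hh K q r hEF hr hq => absurd (hh₀ h hh K q r hq hEF) (not_lt.2 hr)⟩


/-! ### the explicit recipe: UDISJ rows pushed along `ι`, per-row tilts, per-column cliques and generators -/

/-- `(bbᵀ)(x,x')` as a product of indicators. -/
theorem corVec_top_apply_mul {h : ℕ} (b : Fin h → Bool) (x x' : Fin h) :
    corVec (⊤ : SimpleGraph (Fin h)) b (x, x') = (if b x = true then (1 : ℝ) else 0) * (if b x' = true then (1 : ℝ) else 0) := by
  rw [corVec_top_apply]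
  cases b x <;> cases b x' <;> simp

/-- **the UDISJ ROW of `a ⊆ Fin m` pushed along `ι`**: `+1` on the diagonal entries `(ι i, ι i)`, `i ∈ a`, `−1` on the entries `(ι i, ι i')`,
`i ≠ i' ∈ a`; on a clique point it reads `t (2 − t)`, `t = #{i ∈ a : b (ι i)}` (`udF_dotProduct_corVec`), i.e. slack `(t − 1)²` below `1`. -/
noncomputable def udF {m h : ℕ} (ι : Fin m ↪ Fin h) (a : Finset (Fin m)) : Fin h × Fin h → ℝ :=
  ∑ i ∈ a, (unitEntry (ι i, ι i) - ∑ i' ∈ a.erase i, unitEntry (ι i, ι i'))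

/-- `udF ι a · y` entrywise. -/
theorem udF_dotProduct {m h : ℕ} (ι : Fin m ↪ Fin h) (a : Finset (Fin m)) (y : Fin h × Fin h → ℝ) :
    udF ι a ⬝ᵥ y = ∑ i ∈ a, (y (ι i, ι i) - ∑ i' ∈ a.erase i, y (ι i, ι i')) := by
  unfold udF
  rw [sum_dotProduct]
  refine sum_congr rfl fun i _ => ?_
  rw [sub_dotProduct, unitEntry_dotProduct, sum_dotProduct]
  congr 1
  exact sum_congr rfl fun i' _ => unitEntry_dotProduct _ _

/-- ★ `udF ι a · bbᵀ = t (2 − t)` with `t = Σ_{i ∈ a} [b (ι i)]`. -/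
theorem udF_dotProduct_corVec {m h : ℕ} (ι : Fin m ↪ Fin h) (a : Finset (Fin m)) (b : Fin h → Bool) :
    udF ι a ⬝ᵥ corVec (⊤ : SimpleGraph (Fin h)) b =
      (∑ i ∈ a, if b (ι i) = true then (1 : ℝ) else 0) * (2 - ∑ i ∈ a, if b (ι i) = true then (1 : ℝ) else 0) := by
  rw [udF_dotProduct]
  set β : Fin m → ℝ := fun i => if b (ι i) = true then 1 else 0 with hβ
  have hβ2 : ∀ i, β i * β i = β i := fun i => by
    simp only [hβ]
    split_ifs <;> norm_num
  have hdiag : ∀ i, corVec (⊤ : SimpleGraph (Fin h)) b (ι i, ι i) = β i := fun i => by rw [corVec_top_apply_mul]; exact hβ2 i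
  have hoff : ∀ i i', corVec (⊤ : SimpleGraph (Fin h)) b (ι i, ι i') = β i * β i' := fun i i' => corVec_top_apply_mul b _ _
  have h1 : ∀ i ∈ a, (corVec (⊤ : SimpleGraph (Fin h)) b (ι i, ι i) - ∑ i' ∈ a.erase i, corVec (⊤ : SimpleGraph (Fin h)) b (ι i, ι i')) =
      2 * β i - β i * ∑ i' ∈ a, β i' := fun i hi => by
    rw [hdiag, sum_congr rfl fun i' _ => hoff i i', ← mul_sum, sum_erase_eq_sub hi, mul_sub, hβ2]
    ring
  rw [sum_congr rfl h1, sum_sub_distrib, ← sum_mul, ← mul_sum]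
  ring

/-- `Σ_{i ∈ a} [i ∈ b] = #(a ∩ b)`. -/
theorem sum_indicator_eq_card {m : ℕ} (a b : Finset (Fin m)) : (∑ i ∈ a, if i ∈ b then (1 : ℝ) else 0) = ((a ∩ b).card : ℝ) := by
  rw [Finset.sum_ite_mem, Finset.sum_const, nsmul_eq_mul, mul_one]

/-- ★★ **THE RECIPE** (genus I in one statement): a coordinate injection `ι : Fin m ↪ Fin h`, ROW TILTS `W a` valid on `COR(K_h)` (bound
`M a`), COLUMN CLIQUES `B b` extending the pattern `b` along `ι` and tight for `W a` whenever `#(a ∩ b) = 1`, and COLUMN GENERATORS `v b`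
maximising the row functional `udF ι a + W a` over the family whenever `#(a ∩ b) = 1` ⇒ a unique-disjointness pattern of order `m`
(rows `udF ι a + W a ≤ 1 + M a + max_j`, columns `B b (B b)ᵀ + q (v b)`, slack `(t−1)² + (M a − W a·B bB bᵀ) + (max − value)`). -/
theorem uPatAt_of_rows {h K m : ℕ} (q : Fam h K) (ι : Fin m ↪ Fin h) (W : Finset (Fin m) → (Fin h × Fin h → ℝ))
    (M : Finset (Fin m) → ℝ) (B : Finset (Fin m) → (Fin h → Bool)) (v : Finset (Fin m) → Fin (K + 1))
    (hval : ∀ a (b' : Fin h → Bool), W a ⬝ᵥ corVec (⊤ : SimpleGraph (Fin h)) b' ≤ M a)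
    (hext : ∀ b (i : Fin m), B b (ι i) = decide (i ∈ b))
    (htight : ∀ a b, (a ∩ b).card = 1 → W a ⬝ᵥ corVec (⊤ : SimpleGraph (Fin h)) (B b) = M a)
    (htop : ∀ a b, (a ∩ b).card = 1 → ∀ j, (udF ι a + W a) ⬝ᵥ q j ≤ (udF ι a + W a) ⬝ᵥ q (v b)) :
    UPatAt q m := by
  classical
  have hS : ∀ a b, (∑ i ∈ a, if B b (ι i) = true then (1 : ℝ) else 0) = ((a ∩ b).card : ℝ) := fun a b => by
    rw [← sum_indicator_eq_card]
    refine sum_congr rfl fun i _ => ?_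
    rw [hext b i]
    by_cases hi : i ∈ b <;> simp [hi]
  refine ⟨fun a => udF ι a + W a, fun a => 1 + M a + Finset.univ.sup' Finset.univ_nonempty (fun j => (udF ι a + W a) ⬝ᵥ q j),
    fun b => corVec (⊤ : SimpleGraph (Fin h)) (B b) + q (v b), ?_, ?_, ?_, ?_⟩
  · intro a y hy
    obtain ⟨y₁, hy₁, y₂, hy₂, rfl⟩ := Set.mem_add.mp hy
    have h1 : (udF ι a + W a) ⬝ᵥ y₁ ≤ 1 + M a := by
      refine XcDivision.dot_le_of_mem_convexHull _ (udF ι a + W a) _ ?_ y₁ hy₁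
      rintro _ ⟨b', rfl⟩
      rw [add_dotProduct, udF_dotProduct_corVec]
      nlinarith [hval a b', sq_nonneg ((∑ i ∈ a, if b' (ι i) = true then (1 : ℝ) else 0) - 1)]
    have h2 : (udF ι a + W a) ⬝ᵥ y₂ ≤ Finset.univ.sup' Finset.univ_nonempty (fun j => (udF ι a + W a) ⬝ᵥ q j) := by
      refine XcDivision.dot_le_of_mem_convexHull _ (udF ι a + W a) _ ?_ y₂ hy₂
      rintro _ ⟨j, rfl⟩
      exact Finset.le_sup' (fun j => (udF ι a + W a) ⬝ᵥ q j) (Finset.mem_univ j)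
    rw [dotProduct_add]
    linarith
  · intro b
    exact Set.add_mem_add (subset_convexHull ℝ _ ⟨B b, rfl⟩) (subset_convexHull ℝ _ ⟨v b, rfl⟩)
  · intro a b hab
    dsimp only
    have hu : udF ι a ⬝ᵥ corVec (⊤ : SimpleGraph (Fin h)) (B b) = 1 := by
      rw [udF_dotProduct_corVec, hS, hab]
      norm_num
    have ht : (udF ι a + W a) ⬝ᵥ q (v b) = Finset.univ.sup' Finset.univ_nonempty (fun j => (udF ι a + W a) ⬝ᵥ q j) :=
      le_antisymm (Finset.le_sup' (fun j => (udF ι a + W a) ⬝ᵥ q j) (Finset.mem_univ _))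
        (Finset.sup'_le _ _ fun j _ => htop a b hab j)
    rw [dotProduct_add, add_dotProduct, hu, htight a b hab, ← ht]
  · intro a b hab
    dsimp only
    have hu : udF ι a ⬝ᵥ corVec (⊤ : SimpleGraph (Fin h)) (B b) = 0 := by
      rw [udF_dotProduct_corVec, hS, Finset.disjoint_iff_inter_eq_empty.mp hab]
      simp
    have ht : (udF ι a + W a) ⬝ᵥ q (v b) ≤ Finset.univ.sup' Finset.univ_nonempty (fun j => (udF ι a + W a) ⬝ᵥ q j) :=
      Finset.le_sup' (fun j => (udF ι a + W a) ⬝ᵥ q j) (Finset.mem_univ _)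
    rw [dotProduct_add, add_dotProduct, hu]
    have := hval a (B b)
    linarith

/-- ★ COMMON TOP (the pen's located species, 38's common-maximiser rows, in this currency): ONE tilt `w` free on `ι` and ONE generator
maximising every tilted UDISJ row ⇒ a pattern of order `m`. -/
theorem uPatAt_of_commonTop {h K m : ℕ} (q : Fam h K) (ι : Fin m ↪ Fin h) (w : Fin h × Fin h → ℝ) (M : ℝ)
    (hval : ∀ b : Fin h → Bool, w ⬝ᵥ corVec (⊤ : SimpleGraph (Fin h)) b ≤ M)
    (hfree : ∀ c : Fin m → Bool, ∃ b : Fin h → Bool, w ⬝ᵥ corVec (⊤ : SimpleGraph (Fin h)) b = M ∧ b ∘ ι = c)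
    (j₀ : Fin (K + 1)) (htop : ∀ (a : Finset (Fin m)) (j : Fin (K + 1)), (udF ι a + w) ⬝ᵥ q j ≤ (udF ι a + w) ⬝ᵥ q j₀) :
    UPatAt q m := by
  classical
  choose B hB using fun b : Finset (Fin m) => hfree (fun i => decide (i ∈ b))
  exact uPatAt_of_rows q ι (fun _ => w) (fun _ => M) B (fun _ => j₀) (fun _ b' => hval b') (fun b i => congrFun (hB b).2 i)
    (fun a b _ => (hB b).1) (fun a b _ j => htop a j)

/-- ★ QUIET FAMILIES carry the full-order pattern (`W = 0`, any generator). -/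
theorem uPatAt_of_quiet {h K : ℕ} {q : Fam h K} (hq : Quiet h K q) : UPatAt q h := by
  classical
  refine uPatAt_of_rows q (Function.Embedding.refl (Fin h)) (fun _ => 0) (fun _ => 0) (fun b x => decide (x ∈ b)) (fun _ => 0)
    (fun a b' => by rw [zero_dotProduct]) (fun b i => rfl) (fun a b _ => by rw [zero_dotProduct]) (fun a b _ j => ?_)
  rw [hq j]

/-- `Quiet ≤ UPatF s` for every floor `s h ≤ h`. -/
theorem quiet_le_uPatF {s : ℕ → ℕ} (hs : ∀ h, s h ≤ h) {h K : ℕ} {q : Fam h K} (hq : Quiet h K q) : UPatF s h K q :=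
  ⟨h, hs h, uPatAt_of_quiet hq⟩

end Summit.ValiantsHypothesis.ValiantsHypothesis.Theorems.FifoMatching.Localization
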